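import Literature.NumberTheory.LFunctions.WeilTwoPrimeOddMarginKBase
import Literature.NumberTheory.LFunctions.WeilTwoPrimeOddMarginKDataP9
import Literature.NumberTheory.LFunctions.WeilBlockRowsP
import HarnessLib

/-!
# Two-prime odd-margin certificate K: the materialized block agrees with `P_r`, rows 39–51

`WeilCert.checkPmRow` (row `k` of the claim `Pm_{kl} = P_r(2k+1, 2l+1)`) for certificate K, by `decide +kernel`. Pure proof file; nothing is asserted.
-/

noncomputable section

namespace Literature.NumberTheory.LFunctions

set_option maxHeartbeats 0 in
/-- Row 39 of the materialized block is row 39 of `P_r` (certificate K). [folklore] -/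
theorem checkPmRow1_39_weilCert23K : weilCert23KBase.checkPmRow weilCert23KNu weilCert23KPm 1 39 = true := by
  decide +kernel

set_option maxHeartbeats 0 in
/-- Row 40 of the materialized block is row 40 of `P_r` (certificate K). [folklore] -/
theorem checkPmRow1_40_weilCert23K : weilCert23KBase.checkPmRow weilCert23KNu weilCert23KPm 1 40 = true := by
  decide +kernel

set_option maxHeartbeats 0 in
/-- Row 41 of the materialized block is row 41 of `P_r` (certificate K). [folklore] -/
theorem checkPmRow1_41_weilCert23K : weilCert23KBase.checkPmRow weilCert23KNu weilCert23KPm 1 41 = true := by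
  decide +kernel

set_option maxHeartbeats 0 in
/-- Row 42 of the materialized block is row 42 of `P_r` (certificate K). [folklore] -/
theorem checkPmRow1_42_weilCert23K : weilCert23KBase.checkPmRow weilCert23KNu weilCert23KPm 1 42 = true := by
  decide +kernel

set_option maxHeartbeats 0 in
/-- Row 43 of the materialized block is row 43 of `P_r` (certificate K). [folklore] -/
theorem checkPmRow1_43_weilCert23K : weilCert23KBase.checkPmRow weilCert23KNu weilCert23KPm 1 43 = true := by
  decide +kernel

set_option maxHeartbeats 0 in
/-- Row 44 of the materialized block is row 44 of `P_r` (certificate K). [folklore] -/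
theorem checkPmRow1_44_weilCert23K : weilCert23KBase.checkPmRow weilCert23KNu weilCert23KPm 1 44 = true := by
  decide +kernel

set_option maxHeartbeats 0 in
/-- Row 45 of the materialized block is row 45 of `P_r` (certificate K). [folklore] -/
theorem checkPmRow1_45_weilCert23K : weilCert23KBase.checkPmRow weilCert23KNu weilCert23KPm 1 45 = true := by
  decide +kernel

set_option maxHeartbeats 0 in
/-- Row 46 of the materialized block is row 46 of `P_r` (certificate K). [folklore] -/
theorem checkPmRow1_46_weilCert23K : weilCert23KBase.checkPmRow weilCert23KNu weilCert23KPm 1 46 = true := by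
  decide +kernel

set_option maxHeartbeats 0 in
/-- Row 47 of the materialized block is row 47 of `P_r` (certificate K). [folklore] -/
theorem checkPmRow1_47_weilCert23K : weilCert23KBase.checkPmRow weilCert23KNu weilCert23KPm 1 47 = true := by
  decide +kernel

set_option maxHeartbeats 0 in
/-- Row 48 of the materialized block is row 48 of `P_r` (certificate K). [folklore] -/
theorem checkPmRow1_48_weilCert23K : weilCert23KBase.checkPmRow weilCert23KNu weilCert23KPm 1 48 = true := by
  decide +kernel

set_option maxHeartbeats 0 in
/-- Row 49 of the materialized block is row 49 of `P_r` (certificate K). [folklore] -/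
theorem checkPmRow1_49_weilCert23K : weilCert23KBase.checkPmRow weilCert23KNu weilCert23KPm 1 49 = true := by
  decide +kernel

set_option maxHeartbeats 0 in
/-- Row 50 of the materialized block is row 50 of `P_r` (certificate K). [folklore] -/
theorem checkPmRow1_50_weilCert23K : weilCert23KBase.checkPmRow weilCert23KNu weilCert23KPm 1 50 = true := by
  decide +kernel

set_option maxHeartbeats 0 in
/-- Row 51 of the materialized block is row 51 of `P_r` (certificate K). [folklore] -/
theorem checkPmRow1_51_weilCert23K : weilCert23KBase.checkPmRow weilCert23KNu weilCert23KPm 1 51 = true := by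
  decide +kernel


end Literature.NumberTheory.LFunctions
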